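import Literature.AlgebraicGeometry.Motives.LinearSectionNet
import Literature.AlgebraicGeometry.Motives.FiberNetExistence
import Literature.AlgebraicGeometry.Resolution.RegularSequenceSpread
import Literature.AlgebraicGeometry.Resolution.SmoothOfRegularPerfectField
import Literature.AlgebraicGeometry.Resolution.LinearSectionsChoice
import Literature.AlgebraicGeometry.Resolution.LinearProjection
import Literature.AlgebraicGeometry.Motives.AbelianVarietyIsogenyProofs
import HarnessLib

/-!
# Nets of linear sections exist on every smooth projective variety (Lefschetz nets)

Topic: `Literature/AlgebraicGeometry/Motives` (theorems + one `Prop`-valued structure packaging an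
induction hypothesis; no named facts). Sibling proof file of `Motives/FiberNetExistence`: it proves
`LinearSectionNet.nonempty_fiberNet_of_isSmoothProjective` — **every smooth projective `(m + r)`-fold over an
ALGEBRAICALLY CLOSED field, `r ≥ 1`, carries a net of `r`-folds `X ←σ— X̃ —π→ ℙᵐ`** (`Motives.FiberNet`) —
and from it a second, independent route to the named fact `exists_fiberNet_smoothBase_nonempty` (the
closing `example`; the tree's discharge in `Motives/FiberNetExistenceDischarge` goes through de Jong's
Lemma 4.11/4.12 instead), by the construction of Hartshorne II Example 7.17.3 /
Voisin II §2.1.1 carried out in `Motives/LinearSectionNet` (total space, charts, local structure, section),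
completed here by

* **Bertini, iterated** (`RegularCut`, `isGeneric_regularCut_snoc`, `exists_regularCut`): for generic
  linear forms `a₀, …, a_m` on a regular `X ⊆ ℙᴺ` (tree `Resolution.LinSec.isGeneric_regular_cut`,
  Hartshorne II Thm. 8.18, together with the avoidance of the generic points of the components of the
  previous cut, `Resolution.LinSec.isGeneric_avoid_genPts`) the local rings `𝒪_{X,x}/(a₀, …, a_{j-1})` at
  the closed points of the cut are regular OF DIMENSION `dim 𝒪_{X,x} - j`;
* **good centres** (`goodCentre_of_regularCut`): hence the germs of the forms are part of a regular
  system of parameters, the forms restrict to a quasi-regular sequence on a basic open neighbourhood and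
  the quotient ring there is regular (`Resolution/RegularSequenceSpread`), which is the hypothesis
  `LinearSectionNet.GoodCentre` of the local structure theorems; `exists_goodCentre` adds `F ≠ ∅`
  (a finite morphism `X → ℙᵐ` would force `dim X ≤ m`, `Resolution.LinSec.isFinite_proj`) and `F ≠ X`;
* **assembly** (`isSmoothProjective_total`, `geometricallyConnected_proj_left`, `nonempty_fiberNet`,
  `nonempty_fiberNet_of_isSmoothProjective`): `X̃` is regular hence smooth over the perfect field `k`
  (`Resolution.smooth_of_isRegular_of_perfectField`), irreducible and reduced hence integral, smooth of
  relative dimension `dim X` (read off over `X ∖ F ≅ σ⁻¹(X ∖ F)`), projective, geometrically connected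
  over `k` and with geometrically connected `π`-fibres by the Stein argument with a rational section
  (`SectionStein.geometricallyConnected` of `Motives/FiberNetExistence`, applied to the section
  `LinearSectionNet.sectionAt` through a rational point of the base locus) — so
  `Motives.nonempty_fiberNet_of_core` applies; over `ℂ` the smooth base is then non-empty by generic
  smoothness (`exists_fiberNet_smoothBase_nonempty_of_forall_nonempty`).

## References

* [Hartshorne1977] R. Hartshorne, Algebraic Geometry (1977), I Thm. 7.2, II Example 7.17.3 (p. 217),
  II Thm. 8.18 (p. 230), III Cor. 10.7 (p. 334).
* [Matsumura1987] H. Matsumura, Commutative Ring Theory, Thms. 14.3, 16.2, 19.3.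
* [StacksProject] The Stacks Project, Tag 03H2 (Stein factorisation and connected fibres).
* [VoisinHodgeII2003] C. Voisin, Hodge Theory and Complex Algebraic Geometry II, §2.1.1.
-/

noncomputable section

open CategoryTheory AlgebraicGeometry Limits MonoidalCategory CartesianMonoidalCategory
  HomogeneousLocalization TensorProduct MvPolynomial

universe u

namespace Literature.AlgebraicGeometry.Motives

attribute [local instance] MvPolynomial.gradedAlgebra

namespace LinearSectionNet

open UniversalHyperplaneSection

variable {k : Type u} [Field k] {N m : ℕ} {X : SchemeOver k} (ι : X ⟶ projectiveSpace N k)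

/-- Notation-free abbreviation: the grading of `k[x₀, …, x_N]`. -/
local notation "𝒜" => Segre.grading (Fin (N + 1)) k

attribute [local instance] chartBaseRingAlgebra sectionsAlgebra

/-! ### Bertini: good centres exist (Hartshorne II Thm. 8.18, iterated) -/

section Bertini

open Literature.AlgebraicGeometry.Resolution IsLocalRing
open Literature.AlgebraicGeometry.Morphisms.ProjCech (PP)

/-- **The inductive Bertini property** of linear forms `a₀, …, a_{j-1}` on `X ⊆ ℙᴺ`: at every CLOSED
point `x` of `X ∩ V(a₀, …, a_{j-1})` the local ring `𝒪_{X,x}/(a₀, …, a_{j-1})` is regular of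
dimension `dim 𝒪_{X,x} - j` (so that the germs of the forms are part of a regular system of
parameters). [cite: Hartshorne1977, II Thm. 8.18 and Rem. 8.18.1] -/
structure RegularCut {j : ℕ} (a : Fin j → Fin (N + 1) → k) : Prop where
  /-- regular of the expected dimension at the closed points of the cut -/
  out : ∀ x ∈ LinSec.cutSet (ιPP ι) a, IsClosed ({x} : Set X.left) →
    IsRegularLocalRing (X.left.presheaf.stalk x ⧸ LinSec.cutIdeal (ιPP ι) x a) ∧
      ringKrullDim (X.left.presheaf.stalk x ⧸ LinSec.cutIdeal (ιPP ι) x a) + j =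
        ringKrullDim (X.left.presheaf.stalk x)

/-- The empty family of forms has the Bertini property on a regular `X`. [folklore] -/
theorem regularCut_zero (hreg : Scheme.IsRegular X.left) (a : Fin 0 → Fin (N + 1) → k) :
    RegularCut ι a := by
  refine ⟨fun x _ _ => ?_⟩
  have e : (X.left.presheaf.stalk x ⧸ LinSec.cutIdeal (ιPP ι) x a) ≃+* X.left.presheaf.stalk x :=
    (Ideal.quotEquivOfEq (LinSec.cutIdeal_zero (ιPP ι) x a)).trans (RingEquiv.quotientBot _)
  haveI := hreg x
  exact ⟨IsRegularLocalRing.of_ringEquiv e.symm,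
    by rw [ringKrullDim_eq_of_ringEquiv e, Nat.cast_zero, add_zero]⟩

/-- `V(a₀, …, a_{j-1}, b) = V(a₀, …, a_{j-1}) ∩ V(b)`. [folklore] -/
theorem mem_cutSet_snoc_iff {j : ℕ} (a : Fin j → Fin (N + 1) → k) (b : Fin (N + 1) → k)
    (x : X.left) :
    x ∈ LinSec.cutSet (ιPP ι) (Fin.snoc a b : Fin (j + 1) → Fin (N + 1) → k) ↔
      x ∈ LinSec.cutSet (ιPP ι) a ∧ x ∈ LinSec.hyp (ιPP ι) b := by
  simp only [LinSec.cutSet, Set.mem_iInter]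
  constructor
  · intro hx
    refine ⟨fun i => ?_, ?_⟩
    · simpa [Fin.snoc_castSucc] using hx (Fin.castSucc i)
    · simpa [Fin.snoc_last] using hx (Fin.last j)
  · rintro ⟨h1, h2⟩ i
    refine Fin.lastCases ?_ (fun i => ?_) i
    · simpa [Fin.snoc_last] using h2
    · simpa [Fin.snoc_castSucc] using h1 i

variable [IsClosedImmersion ι.left]

/-- **Bertini step.** If `a₀, …, a_{j-1}` have the Bertini property, then so do
`a₀, …, a_{j-1}, b` for GENERIC `b`: take `b` in the intersection of the generic set of Bertini's
theorem (`Resolution.LinSec.isGeneric_regular_cut`: regularity is kept at the closed points) with the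
generic set of forms avoiding the generic points of the irreducible components of
`X ∩ V(a₀, …, a_{j-1})` (`Resolution.LinSec.isGeneric_avoid_genPts`); the latter makes the germ of `b`
a NON-ZERO element of the domain `𝒪_{X,x}/(a)`, so the dimension drops by exactly one.
[cite: Hartshorne1977, II Thm. 8.18 and Rem. 8.18.1] -/
theorem isGeneric_regularCut_snoc [IsAlgClosed k] [IsNoetherian X.left] {j : ℕ}
    (a : Fin j → Fin (N + 1) → k) (ha : RegularCut ι a) :
    IsGeneric fun b : Fin (N + 1) → k =>
      RegularCut ι (Fin.snoc a b : Fin (j + 1) → Fin (N + 1) → k) := by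
  refine ((LinSec.isGeneric_regular_cut (ιPP ι) a).and
    (LinSec.isGeneric_avoid_genPts (ιPP ι) (LinSec.cutSet (ιPP ι) a))).mono fun b hb => ?_
  obtain ⟨hb1, hb2⟩ := hb
  refine ⟨fun x hx hxc => ?_⟩
  obtain ⟨hxa, hxb⟩ := (mem_cutSet_snoc_iff ι a b x).mp hx
  obtain ⟨hrega, hdima⟩ := ha.out x hxa hxc
  refine ⟨hb1 x hxc hxa hxb hrega, ?_⟩
  obtain ⟨h, hxh⟩ := LinSec.exists_mem_chart (ιPP ι) x
  haveI : IsRegularLocalRing (X.left.presheaf.stalk x ⧸ LinSec.cutIdeal (ιPP ι) x a) := hrega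
  -- notation
  set I := LinSec.cutIdeal (ιPP ι) x a with hI
  set g := X.left.presheaf.germ (LinSec.chart (ιPP ι) h) x hxh (LinSec.linSec (ιPP ι) h b) with hg
  have hsnoc : LinSec.cutIdeal (ιPP ι) x (Fin.snoc a b : Fin (j + 1) → Fin (N + 1) → k) =
      I ⊔ Ideal.span {g} := LinSec.cutIdeal_snoc (ιPP ι) x a b hxh
  -- `ḡ ≠ 0` in the domain `𝒪_{X,x}/(a)`: otherwise `b` would contain the component of `V(a)` through `x`
  have hg0 : Ideal.Quotient.mk I g ≠ 0 := by
    intro h0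
    rw [Ideal.Quotient.eq_zero_iff_mem, hI, LinSec.cutIdeal_eq_map_secIdeal (ιPP ι) h hxh a] at h0
    letI := (X.left.presheaf.germ (LinSec.chart (ιPP ι) h) x hxh).hom.toAlgebra
    haveI := LinSec.isLocalization_stalk (ιPP ι) h x hxh
    obtain ⟨c, hc, hcb⟩ := (IsLocalization.algebraMap_mem_map_algebraMap_iff
      (LinSec.ptIdeal (ιPP ι) h x hxh).primeCompl (X.left.presheaf.stalk x) _ _).mp h0
    obtain ⟨w, hw, hwx⟩ :=
      LinSec.exists_genPts_specializes (LinSec.isClosed_cutSet (ιPP ι) a) hxa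
    have hwa : w ∈ LinSec.cutSet (ιPP ι) a := LinSec.genPts_subset _ hw
    have hwh : w ∈ LinSec.chart (ιPP ι) h := hwx.mem_open (LinSec.chart (ιPP ι) h).isOpen hxh
    have hxc' : x ∈ X.left.basicOpen c := by
      rw [Scheme.mem_basicOpen _ c x hxh]
      exact not_not.mp (mt (LinSec.mem_ptIdeal_iff (ιPP ι) h hxh c).mpr hc)
    have hcw : c ∉ LinSec.ptIdeal (ιPP ι) h w hwh := by
      rw [LinSec.mem_ptIdeal_iff, not_not, ← Scheme.mem_basicOpen]
      exact hwx.mem_open (X.left.basicOpen c).isOpen hxc'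
    have hmem : c * LinSec.linSec (ιPP ι) h b ∈ LinSec.ptIdeal (ιPP ι) h w hwh :=
      LinSec.secIdeal_le_ptIdeal (ιPP ι) h hwh hwa hcb
    have hb' := ((inferInstance : (LinSec.ptIdeal (ιPP ι) h w hwh).IsPrime).mem_or_mem
      hmem).resolve_left hcw
    exact hb2 w hw ((LinSec.mem_hyp_iff_linSec_mem_ptIdeal (ιPP ι) h hwh b).mpr hb')
  -- `ḡ` lies in the maximal ideal
  have hgm : Ideal.Quotient.mk I g ∈ maximalIdeal (X.left.presheaf.stalk x ⧸ I) := by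
    have hgu : ¬IsUnit g := (LinSec.mem_hyp_iff_not_isUnit_germ (ιPP ι) hxh b).mp hxb
    haveI := IsLocalHom.of_surjective (Ideal.Quotient.mk I) Ideal.Quotient.mk_surjective
    exact (mem_maximalIdeal _).mpr fun hu => hgu (isUnit_of_map_unit (Ideal.Quotient.mk I) g hu)
  have hjac : Ideal.Quotient.mk I g ∈ Ring.jacobson (X.left.presheaf.stalk x ⧸ I) := by
    rw [← Ideal.jacobson_bot, jacobson_eq_maximalIdeal ⊥ bot_ne_top]
    exact hgm
  haveI : IsDomain (X.left.presheaf.stalk x ⧸ I) := isDomain_of_isRegularLocalRing _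
  have hdrop := ringKrullDim_quotient_span_singleton_succ_eq_ringKrullDim_of_mem_jacobson
    (show IsSMulRegular (X.left.presheaf.stalk x ⧸ I) (Ideal.Quotient.mk I g) from
      fun _ _ h => mul_left_cancel₀ hg0 h) hjac
  -- assemble the dimension count
  have e : X.left.presheaf.stalk x ⧸
      LinSec.cutIdeal (ιPP ι) x (Fin.snoc a b : Fin (j + 1) → Fin (N + 1) → k) ≃+*
        (X.left.presheaf.stalk x ⧸ I) ⧸ Ideal.span {Ideal.Quotient.mk I g} := by
    refine (Ideal.quotEquivOfEq hsnoc).trans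
      ((DoubleQuot.quotQuotEquivQuotSup I (Ideal.span {g})).symm.trans (Ideal.quotEquivOfEq ?_))
    rw [Ideal.map_span, Set.image_singleton]
  rw [ringKrullDim_eq_of_ringEquiv e, ← hdima, ← hdrop, Nat.cast_succ, add_assoc, add_comm (1 : WithBot ℕ∞)]

/-- **Iterated Bertini**: on a regular projective `X ⊆ ℙᴺ` over an algebraically closed field there
are, for every `j`, linear forms `a₀, …, a_{j-1}` with the Bertini property whose first member misses
any given finite set of points. [cite: Hartshorne1977, II Thm. 8.18 and Rem. 8.18.1] -/
theorem exists_regularCut [IsAlgClosed k] [IsNoetherian X.left] (hreg : Scheme.IsRegular X.left)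
    {S : Set X.left} (hS : S.Finite) :
    ∀ j : ℕ, ∃ a : Fin j → Fin (N + 1) → k, RegularCut ι a ∧ ∀ (i : Fin j), ∀ s ∈ S,
      s ∉ LinSec.hyp (ιPP ι) (a i) := by
  intro j
  induction j with
  | zero => exact ⟨Fin.elim0, regularCut_zero ι hreg _, fun i => Fin.elim0 i⟩
  | succ j ih =>
    obtain ⟨a, ha, haS⟩ := ih
    obtain ⟨b, hb, hbS⟩ := ((isGeneric_regularCut_snoc ι a ha).and
      (LinSec.isGeneric_forall_notMem_hyp (ιPP ι) hS)).nonempty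
    refine ⟨Fin.snoc a b, hb, fun i => Fin.lastCases ?_ (fun i => ?_) i⟩
    · simpa [Fin.snoc_last] using hbS
    · simpa [Fin.snoc_castSucc] using haS i

omit [IsClosedImmersion ι.left] in
/-- Membership in the prime of a point of an affine open: the non-units at the point. [folklore] -/
theorem mem_primeIdealOf_iff {U : X.left.Opens} (hU : IsAffineOpen U) {x : X.left} (hx : x ∈ U)
    (s : Γ(X.left, U)) :
    s ∈ (hU.primeIdealOf ⟨x, hx⟩).asIdeal ↔ ¬IsUnit (X.left.presheaf.germ U x hx s) := by
  letI := (X.left.presheaf.germ U x hx).hom.toAlgebra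
  haveI := hU.isLocalization_stalk ⟨x, hx⟩
  rw [← IsLocalization.AtPrime.to_map_mem_maximal_iff (X.left.presheaf.stalk x)
    (hU.primeIdealOf ⟨x, hx⟩).asIdeal s, mem_maximalIdeal, mem_nonunits_iff]
  rfl

/-- **Bertini property ⇒ good centre.** If `a₀, …, a_m` have the Bertini property then the base
locus `F = X ∩ V(a)` has the local structure `GoodCentre`: at a closed point `x ∈ F` the germs are part
of a regular system of parameters of `𝒪_{X,x}` (regular quotient of the right dimension,
`IsRsopPart.of_isRegularLocalRing_quotient`), hence the restrictions of the `aᵢ/x_h` to a basic open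
neighbourhood `D(g)` form a quasi-regular sequence (`exists_isQuasiRegular_away_of_isRsopPart`), and
`Γ(D(g))/(a)` is a regular ring because its localisations at maximal ideals are the regular local
rings `𝒪_{X,y}/(a)`, `y ∈ F ∩ D(g)` closed (`isRegularRing_quotient_of_localization_maximal`); a
non-closed point of `F` lies in the chart of any of its closed specialisations.
[cite: Hartshorne1977, II Thm. 8.18] [cite: Matsumura1987, Thm. 16.2 (i)] -/
theorem goodCentre_of_regularCut [IsNoetherian X.left] [JacobsonSpace X.left]
    (a : Fin (m + 1) → Fin (N + 1) → k) (ha : RegularCut ι a) : GoodCentre ι a := by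
  -- reduction to closed points
  suffices H : ∀ x ∈ baseLocus ι a, IsClosed ({x} : Set X.left) →
      ∃ (h : Fin (N + 1)) (X' : X.left.affineOpens)
        (hX' : (X' : X.left.Opens) ≤ ι.left ⁻¹ᵁ Proj.basicOpen 𝒜 (MvPolynomial.X h)),
        x ∈ (X' : X.left.Opens) ∧ IsQuasiRegular (centre ι a hX') ∧
          IsRegularRing (Γ(X.left, (X' : X.left.Opens)) ⧸ Ideal.span (Set.range (centre ι a hX'))) by
    refine ⟨fun x hx => ?_⟩
    obtain ⟨y, hyx, hyc⟩ := nonempty_inter_closedPoints (⟨x, subset_closure rfl⟩ :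
      (closure ({x} : Set X.left)).Nonempty) isClosed_closure.isLocallyClosed
    have hyF : y ∈ baseLocus ι a :=
      (isClosed_baseLocus ι a).closure_subset_iff.mpr (Set.singleton_subset_iff.mpr hx) hyx
    obtain ⟨h, X', hX', hyX', hq, hr⟩ := H y hyF (mem_closedPoints_iff.mp hyc)
    exact ⟨h, X', hX', (specializes_iff_mem_closure.mpr hyx).mem_open X'.1.isOpen hyX', hq, hr⟩
  intro x hx hxc
  obtain ⟨h, hxh⟩ := LinSec.exists_mem_chart (ιPP ι) x
  have haff := LinSec.isAffineOpen_chart (ιPP ι) h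
  haveI : IsNoetherianRing Γ(X.left, LinSec.chart (ιPP ι) h) :=
    IsLocallyNoetherian.component_noetherian ⟨_, haff⟩
  haveI := LinSec.ptIdeal_isMaximal (ιPP ι) h hxh hxc
  -- the centre in the chart ring and its germs: part of a regular system of parameters
  have hq : IsRsopPart fun i => algebraMap _ (Localization.AtPrime (LinSec.ptIdeal (ιPP ι) h x hxh))
      (LinSec.linSec (ιPP ι) h (a i)) := by
    have hspan : Ideal.span (Set.range fun i => algebraMap _
        (Localization.AtPrime (LinSec.ptIdeal (ιPP ι) h x hxh)) (LinSec.linSec (ιPP ι) h (a i))) =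
        (LinSec.secIdeal (ιPP ι) h a).map (algebraMap _ _) := by
      rw [LinSec.secIdeal, Ideal.map_span, ← Set.range_comp]
      rfl
    obtain ⟨hrx, hdx⟩ := ha.out x hx hxc
    haveI : IsRegularLocalRing (Localization.AtPrime (LinSec.ptIdeal (ιPP ι) h x hxh) ⧸
        Ideal.span (Set.range fun i => algebraMap _
          (Localization.AtPrime (LinSec.ptIdeal (ιPP ι) h x hxh)) (LinSec.linSec (ιPP ι) h (a i)))) := by
      rw [hspan]
      exact (LinSec.isRegularLocalRing_quotient_cutIdeal_iff (ιPP ι) h hxh a).mp hrx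
    refine IsRsopPart.of_isRegularLocalRing_quotient (fun i => ?_) ?_
    · exact (IsLocalization.AtPrime.to_map_mem_maximal_iff _ (LinSec.ptIdeal (ιPP ι) h x hxh) _).mpr
        ((LinSec.mem_hyp_iff_linSec_mem_ptIdeal (ιPP ι) h hxh (a i)).mp (Set.mem_iInter.mp hx i))
    · have e := Ideal.quotientEquiv _ _ (LinSec.stalkEquivAt (ιPP ι) h x hxh)
        (LinSec.cutIdeal_eq_map_stalkEquivAt (ιPP ι) h hxh a)
      rw [hspan, ringKrullDim_eq_of_ringEquiv e,
        ringKrullDim_eq_of_ringEquiv (LinSec.stalkEquivAt (ιPP ι) h x hxh), hdx]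
  -- spread to a basic open neighbourhood `D(g)`
  obtain ⟨g, hgp, hgq⟩ := exists_isQuasiRegular_away_of_isRsopPart _ _ hq
  let X' : X.left.affineOpens := ⟨X.left.basicOpen g, haff.basicOpen g⟩
  have hX'le : (X' : X.left.Opens) ≤ LinSec.chart (ιPP ι) h := X.left.basicOpen_le g
  have hxX' : x ∈ (X' : X.left.Opens) := by
    change x ∈ X.left.basicOpen g
    rw [Scheme.mem_basicOpen _ g x hxh]
    exact not_not.mp (mt (LinSec.mem_ptIdeal_iff (ιPP ι) h hxh g).mpr hgp)
  have hcentre : centre ι a hX'le = fun i => algebraMap Γ(X.left, LinSec.chart (ιPP ι) h)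
      Γ(X.left, X.left.basicOpen g) (LinSec.linSec (ιPP ι) h (a i)) := by
    funext i
    change uForm ι h hX'le (a i) = _
    rw [← map_linSec ι h hX'le (a i)]
    rfl
  haveI : IsLocalization.Away g Γ(X.left, X.left.basicOpen g) := haff.isLocalization_basicOpen g
  refine ⟨h, X', hX'le, hxX', ?_, ?_⟩
  · rw [hcentre]
    exact hgq Γ(X.left, X.left.basicOpen g)
  -- the quotient `Γ(D(g))/(a)` is regular: check at maximal ideals = closed points of `F ∩ D(g)`
  · have hJ : Ideal.span (Set.range (centre ι a hX'le)) = (LinSec.secIdeal (ιPP ι) h a).map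
        (algebraMap Γ(X.left, LinSec.chart (ιPP ι) h) Γ(X.left, X.left.basicOpen g)) := by
      rw [hcentre, LinSec.secIdeal, Ideal.map_span, ← Set.range_comp]
      rfl
    haveI : IsNoetherianRing Γ(X.left, X.left.basicOpen g) :=
      IsLocallyNoetherian.component_noetherian X'
    rw [hJ]
    refine isRegularRing_quotient_of_localization_maximal _ fun P _ hP => ?_
    -- the closed point `y ∈ D(g)` of the maximal ideal `P`
    let y : X.left := X'.2.fromSpec.base ⟨P, inferInstance⟩
    have hy : y ∈ (X' : X.left.Opens) := by
      rw [← SetLike.mem_coe, ← X'.2.range_fromSpec]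
      exact ⟨_, rfl⟩
    have hy'P : X'.2.primeIdealOf ⟨y, hy⟩ = ⟨P, inferInstance⟩ :=
      X'.2.fromSpec.isOpenEmbedding.injective (X'.2.fromSpec_primeIdealOf ⟨y, hy⟩)
    have hyh : y ∈ LinSec.chart (ιPP ι) h := hX'le hy
    -- `y` is a closed point of `X`
    have hyc : IsClosed ({y} : Set X.left) := by
      have h1 := X'.2.fromSpec.isOpenEmbedding.preimage_closedPoints
      have h2 : (⟨P, inferInstance⟩ : PrimeSpectrum Γ(X.left, (X' : X.left.Opens))) ∈
          X'.2.fromSpec.base ⁻¹' closedPoints X.left := by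
        rw [h1]
        exact mem_closedPoints_iff.mpr
          ((PrimeSpectrum.isClosed_singleton_iff_isMaximal _).mpr ‹P.IsMaximal›)
      exact mem_closedPoints_iff.mp h2
    -- `y ∈ F`
    have hmemP : ∀ s : Γ(X.left, LinSec.chart (ιPP ι) h),
        algebraMap _ Γ(X.left, X.left.basicOpen g) s ∈ P ↔ s ∈ LinSec.ptIdeal (ιPP ι) h y hyh := by
      intro s
      have h1 : algebraMap _ Γ(X.left, X.left.basicOpen g) s ∈ (X'.2.primeIdealOf ⟨y, hy⟩).asIdeal ↔ _ :=
        mem_primeIdealOf_iff X'.2 hy _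
      rw [hy'P] at h1
      rw [h1, LinSec.mem_ptIdeal_iff]
      change ¬IsUnit ((X.left.presheaf.germ _ _ hy) ((X.left.presheaf.map (homOfLE _).op) s)) ↔ _
      rw [TopCat.Presheaf.germ_res_apply]
    have hyF : y ∈ baseLocus ι a := by
      refine Set.mem_iInter.mpr fun i => (LinSec.mem_hyp_iff_linSec_mem_ptIdeal (ιPP ι) h hyh (a i)).mpr ?_
      exact (hmemP _).mp (hP (Ideal.mem_map_of_mem _ (Ideal.subset_span ⟨i, rfl⟩)))
    obtain ⟨hry, -⟩ := ha.out y hyF hyc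
    -- the stalk at `y` is the localisation at `P`, and `(a) 𝒪_{X,y} = cutIdeal`
    letI := (X.left.presheaf.germ (X' : X.left.Opens) y hy).hom.toAlgebra
    have hloc : IsLocalization.AtPrime (X.left.presheaf.stalk y) P := by
      have := X'.2.isLocalization_stalk ⟨y, hy⟩
      rw [hy'P] at this
      exact this
    refine ⟨X.left.presheaf.stalk y, inferInstance, inferInstance, hloc, ?_⟩
    have hcut : ((LinSec.secIdeal (ιPP ι) h a).map (algebraMap Γ(X.left, LinSec.chart (ιPP ι) h)
        Γ(X.left, X.left.basicOpen g))).map (algebraMap Γ(X.left, X.left.basicOpen g)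
          (X.left.presheaf.stalk y)) = LinSec.cutIdeal (ιPP ι) y a := by
      rw [LinSec.cutIdeal_eq_map_secIdeal (ιPP ι) h hyh a, Ideal.map_map]
      congr 1
      change (X.left.presheaf.germ _ _ hy).hom.comp (X.left.presheaf.map (homOfLE _).op).hom = _
      rw [← CommRingCat.hom_comp, TopCat.Presheaf.germ_res]
    rw [hcut]
    exact hry

end Bertini

/-! ### Assembly: the net of linear sections of a smooth projective variety -/

section Assembly

open Literature.AlgebraicGeometry.Resolution
open Literature.AlgebraicGeometry.Morphisms.ProjCech (PP)

variable {n : ℕ} (hX : IsSmoothProjective n X) (a : Fin (m + 1) → Fin (N + 1) → k)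

include hX

/-- `X` is integral. [folklore] -/
theorem isIntegral_left : IsIntegral X.left := IsSmoothProjective.isIntegral_holds hX

/-- `X` is regular. [folklore] -/
theorem isRegular_left : Scheme.IsRegular X.left := by
  haveI := hX.smoothOfRelativeDimension
  exact fun x => isRegularLocalRing_stalk_of_smoothOfRelativeDimension X.hom n x

/-- `X` is locally Noetherian. [folklore] -/
theorem isLocallyNoetherian_left : IsLocallyNoetherian X.left := by
  haveI := hX.smoothOfRelativeDimension
  haveI : Smooth X.hom := SmoothOfRelativeDimension.smooth n _
  exact LocallyOfFiniteType.isLocallyNoetherian X.hom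

/-- `X → Spec k` is proper. [folklore] -/
theorem isProper_hom : IsProper X.hom := hX.isProjectiveOver.isProper

/-- `X̃ → Spec k` is locally of finite type. [folklore] -/
theorem locallyOfFiniteType_total_hom : LocallyOfFiniteType (total ι a).hom := by
  haveI := hX.smoothOfRelativeDimension
  haveI : Smooth X.hom := SmoothOfRelativeDimension.smooth n _
  change LocallyOfFiniteType ((totalIdeal ι a).subschemeι ≫ (X ⊗ projectiveSpace m k).hom)
  have : LocallyOfFiniteType (X ⊗ projectiveSpace m k).hom := by
    change LocallyOfFiniteType (pullback.fst X.hom (projectiveSpace m k).hom ≫ X.hom)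
    infer_instance
  infer_instance

/-- `X̃ → Spec k` is proper. [folklore] -/
theorem isProper_total_hom : IsProper (total ι a).hom := by
  haveI := isProper_hom hX
  change IsProper ((totalIdeal ι a).subschemeι ≫ (X ⊗ projectiveSpace m k).hom)
  have : IsProper (X ⊗ projectiveSpace m k).hom := by
    change IsProper (pullback.fst X.hom (projectiveSpace m k).hom ≫ X.hom)
    infer_instance
  infer_instance

variable [IsClosedImmersion ι.left] {a} (hF : GoodCentre ι a)
  (hV : ((offBase ι a : X.left.Opens) : Set X.left).Nonempty)
include hF hV

/-- `X̃` is integral. [folklore] -/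
theorem isIntegral_total_left : IsIntegral (total ι a).left := by
  haveI := isIntegral_left hX
  haveI := irreducibleSpace_total ι a hF hV
  exact isIntegral_of_irreducibleSpace_of_isReduced _

variable [IsAlgClosed k]

/-- **`X̃ → Spec k` is smooth of relative dimension `n = dim X`**: `X̃` is regular
(`isRegular_total`), hence smooth over the perfect field `k`; it is irreducible, hence smooth of ONE
relative dimension, which is read off on the dense open `σ⁻¹(X ∖ F) ≅ X ∖ F`.
[cite: Hartshorne1977, II Thm. 8.24 (b)] -/
theorem smoothOfRelativeDimension_total_hom : SmoothOfRelativeDimension n (total ι a).hom := by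
  haveI := isIntegral_left hX
  haveI := isLocallyNoetherian_left hX
  haveI := locallyOfFiniteType_total_hom ι hX a
  haveI := hX.smoothOfRelativeDimension
  have hreg := isRegular_total ι a (isRegular_left hX) hF
  haveI : Smooth (total ι a).hom := smooth_of_isRegular_of_perfectField _ hreg
  haveI := irreducibleSpace_total ι a hF hV
  obtain ⟨d, hd⟩ := exists_smoothOfRelativeDimension_of_smooth (total ι a).hom
  -- compare the two relative dimensions on `W = σ⁻¹(X ∖ F) ≅ X ∖ F`
  haveI : Nonempty (offBase ι a) := by
    obtain ⟨x, hx⟩ := hV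
    exact ⟨⟨x, hx⟩⟩
  haveI hiso := isIso_blowDown_restrict_offBase ι a
  haveI : Nonempty ((blowDown ι a).left ⁻¹ᵁ offBase ι a) := by
    obtain ⟨w, -⟩ := (inferInstance : Surjective ((blowDown ι a).left ∣_ offBase ι a)).surj
      (Classical.arbitrary _)
    exact ⟨w⟩
  have h1 : SmoothOfRelativeDimension (0 + d) (((blowDown ι a).left ⁻¹ᵁ offBase ι a).ι ≫ (total ι a).hom) :=
    inferInstance
  have h2 : SmoothOfRelativeDimension (0 + (0 + n))
      (((blowDown ι a).left ⁻¹ᵁ offBase ι a).ι ≫ (total ι a).hom) := by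
    have e : ((blowDown ι a).left ⁻¹ᵁ offBase ι a).ι ≫ (total ι a).hom =
        ((blowDown ι a).left ∣_ offBase ι a) ≫ (offBase ι a).ι ≫ X.hom := by
      rw [morphismRestrict_ι_assoc]
      exact congrArg (((blowDown ι a).left ⁻¹ᵁ offBase ι a).ι ≫ ·) (Over.w (blowDown ι a)).symm
    rw [e]
    infer_instance
  have := AbelianVarietyProofs.eq_of_smoothOfRelativeDimension _ h1 h2
  obtain rfl : d = n := by omega
  exact hd

/-- `X̃` has a `k`-rational point. [folklore] -/
theorem exists_algPoints_total : Nonempty (AlgPoints (total ι a) k) := by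
  haveI := isIntegral_total_left ι hX hF hV
  haveI := locallyOfFiniteType_total_hom ι hX a
  have hJ : JacobsonSpace (total ι a).left := LocallyOfFiniteType.jacobsonSpace (total ι a).hom
  obtain ⟨z, -, hz⟩ := nonempty_inter_closedPoints (Set.univ_nonempty (α := (total ι a).left))
    isClosed_univ.isLocallyClosed
  obtain ⟨τ, hτ⟩ := exists_point_through_closedPoint (total ι a).hom k (mem_closedPoints_iff.mp hz)
  exact ⟨AlgPoints.mk (Spec.map τ ≫ (total ι a).left.fromSpecResidueField z) hτ⟩

/-- **`X̃ → Spec k` is geometrically connected**: it is proper with integral source and has a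
rational section (`SectionStein.geometricallyConnected`). [cite: StacksProject, Tag 03H2] -/
theorem geometricallyConnected_total_hom : GeometricallyConnected (total ι a).hom := by
  haveI := isIntegral_total_left ι hX hF hV
  haveI := isProper_total_hom ι hX a
  obtain ⟨s⟩ := exists_algPoints_total ι hX hF hV
  have hs : s.left ≫ (total ι a).hom = 𝟙 _ := by
    rw [Over.w s]
    change Spec.map (CommRingCat.ofHom (algebraMap k k)) = 𝟙 _
    rw [Algebra.algebraMap_self, CommRingCat.ofHom_id]
    exact Spec.map_id _
  exact SectionStein.geometricallyConnected (total ι a).hom s.left hs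

/-- **`X̃` is a smooth projective variety of dimension `n = dim X`.**
[cite: Hartshorne1977, II Example 7.17.3] -/
theorem isSmoothProjective_total : IsSmoothProjective n (total ι a) := by
  haveI := smoothOfRelativeDimension_total_hom ι hX hF hV
  haveI := geometricallyConnected_total_hom ι hX hF hV
  exact ⟨inferInstance, isProjectiveOver_total ι a hX.isProjectiveOver,
    geometricallyIrreducible_of_geometricallyConnected_of_smoothOfRelativeDimension (total ι a).hom n⟩

/-- **The net map `π : X̃ → ℙᵐ` has geometrically connected fibres** as soon as the base locus has a
rational point `β`: `π` is proper, `X̃` is integral and `s_β` is a section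
(`SectionStein.geometricallyConnected`). [cite: StacksProject, Tag 03H2] -/
theorem geometricallyConnected_proj_left (β : AlgPoints X k) (hβ : β.pt ∈ baseLocus ι a) :
    GeometricallyConnected (proj ι a).left := by
  haveI := isIntegral_total_left ι hX hF hV
  haveI := isProper_hom hX
  haveI := isProper_proj_left ι a
  exact SectionStein.geometricallyConnected (proj ι a).left (sectionAt ι a β hβ).left
    (sectionAt_left_proj_left ι a β hβ)

omit hV in
/-- **The net of linear sections.** For a smooth projective variety `X ↪ ℙᴺ` of dimension `m + r`
over an algebraically closed field and linear forms `a₀, …, a_m` whose base locus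
`F = X ∩ V(a₀, …, a_m)` is non-empty, not all of `X`, and has the local structure `GoodCentre`
(Bertini), the incidence variety `X̃ → ℙᵐ` is a net of `r`-folds on `X` (`Motives.FiberNet`).
[cite: Hartshorne1977, II Example 7.17.3] -/
theorem nonempty_fiberNet {r : ℕ} (hn : n = m + r) (hne : (baseLocus ι a).Nonempty)
    (hnu : baseLocus ι a ≠ Set.univ) : Nonempty (FiberNet r m X) := by
  subst hn
  have hV : ((offBase ι a : X.left.Opens) : Set X.left).Nonempty := by
    obtain ⟨x, hx⟩ := (Set.ne_univ_iff_exists_notMem _).mp hnu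
    exact ⟨x, hx⟩
  haveI := isIntegral_left hX
  -- a rational point of the base locus (through a closed point of the closed set `F`)
  haveI := hX.smoothOfRelativeDimension
  haveI : Smooth X.hom := SmoothOfRelativeDimension.smooth (m + r) _
  have hJ : JacobsonSpace X.left := LocallyOfFiniteType.jacobsonSpace X.hom
  obtain ⟨x₀, hx₀F, hx₀⟩ := nonempty_inter_closedPoints hne (isClosed_baseLocus ι a).isLocallyClosed
  obtain ⟨τ, hτ⟩ := exists_point_through_closedPoint X.hom k (mem_closedPoints_iff.mp hx₀)
  let β : AlgPoints X k := AlgPoints.mk (Spec.map τ ≫ X.left.fromSpecResidueField x₀) hτ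
  have hβ : β.pt = x₀ := by
    change (X.left.fromSpecResidueField x₀) ((Spec.map τ) (IsLocalRing.closedPoint k)) = x₀
    exact Scheme.fromSpecResidueField_apply _ _
  haveI := geometricallyConnected_proj_left ι hX hF hV β (hβ ▸ hx₀F)
  exact nonempty_fiberNet_of_core (isSmoothProjective_total ι hX hF hV) (blowDown ι a) (baseLocus ι a)
    (isClosed_baseLocus ι a) hnu (isIso_blowDown_restrict_offBase ι a) (proj ι a)

end Assembly

/-! ### Existence of good centres and of nets; the named fact -/

section Final

open Literature.AlgebraicGeometry.Resolution
open Literature.AlgebraicGeometry.Morphisms.ProjCech (PP)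

/-- `X` (smooth projective) is Noetherian. [folklore] -/
theorem isNoetherian_left {n : ℕ} (hX : IsSmoothProjective n X) : IsNoetherian X.left := by
  haveI := isLocallyNoetherian_left hX
  haveI := isProper_hom hX
  haveI : CompactSpace X.left := QuasiCompact.compactSpace_of_compactSpace X.hom
  exact {}

/-- `X` (smooth projective) is a Jacobson space. [folklore] -/
theorem jacobsonSpace_left {n : ℕ} (hX : IsSmoothProjective n X) : JacobsonSpace X.left := by
  haveI := hX.smoothOfRelativeDimension
  haveI : Smooth X.hom := SmoothOfRelativeDimension.smooth n _
  exact LocallyOfFiniteType.jacobsonSpace X.hom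

/-- **Good centres exist** (Bertini): on a smooth projective `X ⊆ ℙᴺ` of dimension `n ≥ m + 1` over an
algebraically closed field there are linear forms `a₀, …, a_m` whose base locus `F = X ∩ V(a)` is
non-empty (projective dimension theorem: otherwise the projection `X → ℙᵐ` would be a finite morphism,
forcing `dim X ≤ m`), not all of `X` (the first form misses the generic point) and has the local structure
`GoodCentre` (`goodCentre_of_regularCut`). [cite: Hartshorne1977, II Thm. 8.18, I Thm. 7.2] -/
theorem exists_goodCentre [IsAlgClosed k] {n : ℕ} (hX : IsSmoothProjective n X) [IsClosedImmersion ι.left]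
    (hmn : m + 1 ≤ n) :
    ∃ a : Fin (m + 1) → Fin (N + 1) → k,
      GoodCentre ι a ∧ (baseLocus ι a).Nonempty ∧ baseLocus ι a ≠ Set.univ := by
  haveI := isIntegral_left hX
  haveI := isNoetherian_left hX
  haveI := jacobsonSpace_left hX
  haveI := isProper_hom hX
  haveI := hX.smoothOfRelativeDimension
  obtain ⟨a, ha, haS⟩ := exists_regularCut ι (isRegular_left hX)
    (Set.finite_singleton (genericPoint X.left)) (m + 1)
  refine ⟨a, goodCentre_of_regularCut ι a ha, ?_, ?_⟩
  · -- non-empty: otherwise `X → ℙᵐ` is finite and `dim X ≤ m`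
    by_contra hne
    rw [Set.not_nonempty_iff_eq_empty] at hne
    have hbpf : LinSec.NoCommonZero (ιPP ι) a := (LinSec.noCommonZero_iff_cutSet_eq_empty (ιPP ι) a).mpr hne
    haveI := LinSec.isFinite_proj (ιPP ι) a X.hom hbpf
    have hle := Scheme.topologicalKrullDim_le_of_locallyQuasiFinite (LinSec.proj (ιPP ι) a X.hom hbpf)
    rw [topologicalKrullDim_eq_of_smoothOfRelativeDimension X.hom n] at hle
    have hP : topologicalKrullDim (PP k m) = m := ProjSpace.topologicalKrullDim_eq m k
    rw [hP] at hle
    have : n ≤ m := by exact_mod_cast hle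
    omega
  · -- not everything: the generic point of `X` is missed by `a₀`
    intro huniv
    have hη : genericPoint X.left ∈ baseLocus ι a := huniv ▸ Set.mem_univ _
    exact haS 0 _ rfl (Set.mem_iInter.mp hη 0)

/-- **Nets of `r`-folds exist on every smooth projective `(m + r)`-fold, `r ≥ 1`, over an algebraically
closed field**: embed `X ↪ ℙᴺ`, choose a good centre of `m + 1` linear forms (`exists_goodCentre`) and
take the net of linear sections (`nonempty_fiberNet`). [cite: Hartshorne1977, II Example 7.17.3, II Thm. 8.18] -/
theorem nonempty_fiberNet_of_isSmoothProjective [IsAlgClosed k] {r m : ℕ} {X : SchemeOver k}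
    (hr : 1 ≤ r) (hX : IsSmoothProjective (m + r) X) : Nonempty (FiberNet r m X) := by
  obtain ⟨N, ι, hι⟩ := hX.isProjectiveOver
  obtain ⟨a, hF, hne, hnu⟩ := exists_goodCentre (m := m) ι hX (by omega)
  exact nonempty_fiberNet ι hX hF rfl hne hnu

end Final

/-- **A second, independent route to the named fact `exists_fiberNet_smoothBase_nonempty`**
(illustration only: the tree's discharge `Motives.exists_fiberNet_smoothBase_nonempty_holds` in
`Motives/FiberNetExistenceDischarge` goes through de Jong's Lemma 4.11/4.12 and an induction on `r`;
this one is the classical Lefschetz net of linear sections, uniform in `r`): every smooth projective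
`(m + r)`-fold over `ℂ` (`r ≥ 1`) carries a net of `r`-folds with non-empty smooth base — the net of
linear sections of a Bertini-general centre (`nonempty_fiberNet_of_isSmoothProjective`, Hartshorne II
Example 7.17.3 with II Thm. 8.18), whose smooth base is non-empty by generic smoothness in
characteristic zero (`exists_fiberNet_smoothBase_nonempty_of_forall_nonempty`, Hartshorne III
Cor. 10.7). [cite: Hartshorne1977, II Example 7.17.3 (p. 217), II Thm. 8.18 (p. 230), III Cor. 10.7 (p. 334)] -/
example : exists_fiberNet_smoothBase_nonempty :=
  exists_fiberNet_smoothBase_nonempty_of_forall_nonempty fun _ _ _ hr hX =>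
    nonempty_fiberNet_of_isSmoothProjective hr hX

end LinearSectionNet

end Literature.AlgebraicGeometry.Motives

end
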